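import Mathlib.Topology.Algebra.Module.Cardinality
import Mathlib.Topology.Algebra.Polynomial
import Literature.NumberTheory.EllipticCurves.WeierstrassPMultiplication
import Literature.NumberTheory.EllipticCurves.WeierstrassTorsion
import HarnessLib

/-!
# The division polynomials as `σ`-quotients: `ψₙ(℘ z, ℘' z/2) = (−1)ⁿ⁺¹ σ(nz)/σ(z)^{n²}`

Topic `Literature/NumberTheory/EllipticCurves`; a proofs-only file (theorems only) in
`namespace PeriodPair`. For a period pair `L` (lattice `Λ`, `σ = L.weierstrassSigma`, curve
`E_Λ : y² = x³ − (g₂/4)x − g₃/4`, `π(z) = (℘ z, ℘' z/2)`) we prove the classical identification of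
the division polynomials `ψₙ` of `E_Λ` (Mathlib's `WeierstrassCurve.ψ`) with quotients of
Weierstrass `σ`-functions (Silverman, *AEC*, Exercise 6.15:
*"`ψₙ(z) = (−1)^{n+1} σ(nz)/σ(z)^{n²}`"*; Frobenius–Stickelberger 1877), in the multiplied-out
form valid for **every** `z ∈ ℂ` and `n ∈ ℕ`:

* `PeriodPair.weierstrassSigma_nat_mul` —
  `σ(nz) = (−1)^{n+1} · ψₙ(℘ z, ℘' z/2) · σ(z)^{n²}`.

Proof (no elliptic-net theory needed). Off the torsion of order `< n` one compares the two
expressions for `℘(nz) − ℘(z)`: the `σ`-formula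
`℘(u) − ℘(v) = −σ(u−v)σ(u+v)/(σ(u)²σ(v)²)` (tree: `PeriodPair.weierstrassP_sub_eq_sigma_holds`) with
`u = nz`, `v = z`, and the multiplication formula `℘(nz) = φₙ/ψₙ²` (tree:
`PeriodPair.weierstrassP_int_mul`, file `WeierstrassPMultiplication.lean`) together with the
*definition* `φₙ = xψₙ² − ψₙ₊₁ψₙ₋₁`, i.e. `℘(nz) − ℘(z) = −ψₙ₊₁ψₙ₋₁/ψₙ²`
(`PeriodPair.weierstrassP_nat_mul_sub_weierstrassP`). Hence
`σ((n+1)z)σ((n−1)z)/σ(nz)² = σ(z)² ψₙ₊₁ψₙ₋₁/ψₙ²`, and a two-step induction from `σ(0) = 0`,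
`σ(z) = σ(z)`, `σ(2z) = −℘'(z)σ(z)⁴` (tree: `PeriodPair.derivWeierstrassP_eq_sigma`) gives the
identity whenever `z, 2z, …, (n−1)z ∉ Λ` (`weierstrassSigma_nat_mul_of_forall_notMem`). Both sides
being continuous on `ℂ ∖ Λ` and the non-torsion points being dense (complement of a countable
set), the identity holds on `ℂ ∖ Λ`, and trivially on `Λ`.

This is step S3 of the programme recorded in `WeierstrassPMultiplication.lean` (division values
and heights of the `t`-coordinate of `E♮` for Baker's method at non-torsion points,
Baker–Wüstholz 2007, §6.8): its logarithmic derivative is the division formula for `ζ`,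
`ζ(nz) − nζ(z) = (1/n) · (d/dz) log ψₙ(℘ z, ℘' z/2)`.

## References

* J. H. Silverman, *The Arithmetic of Elliptic Curves*, 2nd ed., GTM 106, Springer 2009,
  Exercise 6.15 (held text, PDF chunk 173), Exercise 3.7. [SilvermanAEC2009]
* E. T. Whittaker, G. N. Watson, *A Course of Modern Analysis*, 4th ed., CUP 1927, §20.53,
  Example 20.24 (`σ(2u)/σ⁴(u) = −℘'(u)`), Examples XX.20–24 (p. 458–459: `ψₙ` via `σ`).
* A. Baker, G. Wüstholz, *Logarithmic Forms and Diophantine Geometry*, CUP 2007, §6.8.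
  [BakerWustholz2007]
-/

noncomputable section

open Complex Polynomial Set Filter Topology
open scoped Polynomial.Bivariate

namespace PeriodPair

variable (L : PeriodPair)

/-! ### `℘(nz) − ℘(z) = −ψₙ₊₁ψₙ₋₁/ψₙ²` -/

/-- The value of `φₙ` at a point in terms of the values of `ψₙ, ψₙ₊₁, ψₙ₋₁`
(`φₙ = Xψₙ² − ψₙ₊₁ψₙ₋₁` by definition). [cite: SilvermanAEC2009, Exercise 3.7] -/
theorem evalEval_φ_eq {R : Type*} [CommRing R] (W : WeierstrassCurve R) (n : ℤ) (x y : R) :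
    (W.φ n).evalEval x y =
      x * (W.ψ n).evalEval x y ^ 2 - (W.ψ (n + 1)).evalEval x y * (W.ψ (n - 1)).evalEval x y := by
  rw [WeierstrassCurve.φ, evalEval_sub, evalEval_mul, evalEval_mul, evalEval_pow, evalEval_C,
    eval_X]

variable {L}

/-- **`℘(nz) − ℘(z) = −ψₙ₊₁ψₙ₋₁/ψₙ²`** (values at `(℘ z, ℘' z/2)`) for `z, nz ∉ Λ`, `n ∈ ℤ`: the
multiplication formula `℘(nz) = φₙ/ψₙ²` with `φₙ = Xψₙ² − ψₙ₊₁ψₙ₋₁`.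
[cite: SilvermanAEC2009, Exercise 3.7(d)] -/
theorem weierstrassP_int_mul_sub_weierstrassP {z : ℂ} (hz : z ∉ L.lattice) {n : ℤ}
    (hnz : (n : ℂ) * z ∉ L.lattice) :
    ℘[L] (n * z) - ℘[L] z =
      -((L.curve.ψ (n + 1)).evalEval (℘[L] z) (℘'[L] z / 2) *
          (L.curve.ψ (n - 1)).evalEval (℘[L] z) (℘'[L] z / 2)) /
        (L.curve.ψ n).evalEval (℘[L] z) (℘'[L] z / 2) ^ 2 := by
  have hψ : (L.curve.ψ n).evalEval (℘[L] z) (℘'[L] z / 2) ≠ 0 :=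
    fun h => hnz ((L.evalEval_ψ_eq_zero_iff hz n).mp h)
  rw [(L.weierstrassP_int_mul hz hnz).1, evalEval_φ_eq]
  field_simp
  ring

/-! ### The induction off the torsion of small order -/

/-- `ψ₀ = 0`, `ψ₁ = 1`, `ψ₂(℘ z, ℘' z/2) = ℘'(z)` on `E_Λ`. [folklore] -/
theorem evalEval_ψ_two (x y : ℂ) : (L.curve.ψ 2).evalEval x y = 2 * y := by
  rw [WeierstrassCurve.ψ_two, WeierstrassCurve.ψ₂, WeierstrassCurve.Affine.evalEval_polynomialY]
  simp only [WeierstrassCurve.toAffine, curve_a₁, curve_a₃, zero_mul, add_zero]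

/-- `σ(2z) = −℘'(z) σ(z)⁴` (Whittaker–Watson, Example 20.24; tree:
`PeriodPair.derivWeierstrassP_eq_sigma`). [folklore] -/
theorem weierstrassSigma_two_mul {z : ℂ} (hz : z ∉ L.lattice) :
    L.weierstrassSigma (2 * z) = -(℘'[L] z) * L.weierstrassSigma z ^ 4 := by
  have h4 : L.weierstrassSigma z ^ 4 ≠ 0 := pow_ne_zero 4 (L.weierstrassSigma_ne_zero hz)
  rw [L.derivWeierstrassP_eq_sigma hz, neg_div, neg_neg, div_mul_cancel₀ _ h4]

/-- The induction step of Exercise 6.15: from the identity for `m+1` and `m+2` (and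
`z, (m+1)z, (m+2)z ∉ Λ`) to the identity for `m+3`, by comparing the `σ`-formula for
`℘((m+2)z) − ℘(z)` with `−ψ_{m+3}ψ_{m+1}/ψ_{m+2}²`. [cite: SilvermanAEC2009, Exercise 6.15] -/
theorem weierstrassSigma_nat_mul_step {z : ℂ} (m : ℕ) (hz : z ∉ L.lattice)
    (hm1 : ((m + 1 : ℕ) : ℂ) * z ∉ L.lattice) (hm2 : ((m + 2 : ℕ) : ℂ) * z ∉ L.lattice)
    (hP1 : L.weierstrassSigma (((m + 1 : ℕ) : ℂ) * z) =
      (-1) ^ (m + 1 + 1) * (L.curve.ψ ((m + 1 : ℕ) : ℤ)).evalEval (℘[L] z) (℘'[L] z / 2) *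
        L.weierstrassSigma z ^ ((m + 1) ^ 2))
    (hP2 : L.weierstrassSigma (((m + 2 : ℕ) : ℂ) * z) =
      (-1) ^ (m + 2 + 1) * (L.curve.ψ ((m + 2 : ℕ) : ℤ)).evalEval (℘[L] z) (℘'[L] z / 2) *
        L.weierstrassSigma z ^ ((m + 2) ^ 2)) :
    L.weierstrassSigma (((m + 3 : ℕ) : ℂ) * z) =
      (-1) ^ (m + 3 + 1) * (L.curve.ψ ((m + 3 : ℕ) : ℤ)).evalEval (℘[L] z) (℘'[L] z / 2) *
        L.weierstrassSigma z ^ ((m + 3) ^ 2) := by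
  -- the two expressions for `℘((m+2) z) - ℘(z)`
  have E1 := L.weierstrassP_sub_eq_sigma_holds (((m + 2 : ℕ) : ℂ) * z) z hm2 hz
  have hm2' : (((m + 2 : ℕ) : ℤ) : ℂ) * z ∉ L.lattice := by simpa using hm2
  have E2 := weierstrassP_int_mul_sub_weierstrassP hz hm2'
  have c1 : (((m + 2 : ℕ) : ℤ) : ℂ) * z = ((m + 2 : ℕ) : ℂ) * z := by push_cast; ring
  have c2 : ((m + 2 : ℕ) : ℤ) + 1 = ((m + 3 : ℕ) : ℤ) := by push_cast; ring
  have c3 : ((m + 2 : ℕ) : ℤ) - 1 = ((m + 1 : ℕ) : ℤ) := by push_cast; ring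
  rw [c1, c2, c3] at E2
  have d1 : ((m + 2 : ℕ) : ℂ) * z - z = ((m + 1 : ℕ) : ℂ) * z := by push_cast; ring
  have d2 : ((m + 2 : ℕ) : ℂ) * z + z = ((m + 3 : ℕ) : ℂ) * z := by push_cast; ring
  rw [d1, d2, E2] at E1
  -- non-vanishing
  have hs0 : L.weierstrassSigma z ≠ 0 := L.weierstrassSigma_ne_zero hz
  have hσ2 : L.weierstrassSigma (((m + 2 : ℕ) : ℂ) * z) ≠ 0 := L.weierstrassSigma_ne_zero hm2
  have hψ1 : (L.curve.ψ ((m + 1 : ℕ) : ℤ)).evalEval (℘[L] z) (℘'[L] z / 2) ≠ 0 := fun h0 =>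
    hm1 (by simpa using (L.evalEval_ψ_eq_zero_iff hz ((m + 1 : ℕ) : ℤ)).mp h0)
  have hψ2 : (L.curve.ψ ((m + 2 : ℕ) : ℤ)).evalEval (℘[L] z) (℘'[L] z / 2) ≠ 0 := fun h0 =>
    hm2 (by simpa using (L.evalEval_ψ_eq_zero_iff hz ((m + 2 : ℕ) : ℤ)).mp h0)
  -- cross-multiply: `ψ₃ ψ₁ (σ₂² σ(z)²) = σ₁ σ₃ ψ₂²`
  rw [neg_div, neg_div, neg_inj,
    div_eq_div_iff (pow_ne_zero 2 hψ2) (mul_ne_zero (pow_ne_zero 2 hσ2) (pow_ne_zero 2 hs0))] at E1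
  -- substitute the induction hypotheses and cancel `(-1)^{m+2} ψ₁ σ(z)^{(m+1)²} ψ₂² ≠ 0`
  rw [hP1, hP2] at E1
  have hc : (-1 : ℂ) ^ (m + 1 + 1) * (L.curve.ψ ((m + 1 : ℕ) : ℤ)).evalEval (℘[L] z) (℘'[L] z / 2) *
      L.weierstrassSigma z ^ ((m + 1) ^ 2) *
        (L.curve.ψ ((m + 2 : ℕ) : ℤ)).evalEval (℘[L] z) (℘'[L] z / 2) ^ 2 ≠ 0 :=
    mul_ne_zero (mul_ne_zero (mul_ne_zero (pow_ne_zero _ (neg_ne_zero.mpr one_ne_zero)) hψ1)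
      (pow_ne_zero _ hs0)) (pow_ne_zero _ hψ2)
  refine mul_left_cancel₀ hc ?_
  linear_combination -E1

/-- **`σ(nz) = (−1)^{n+1} ψₙ(℘ z, ℘' z/2) σ(z)^{n²}` when `z, 2z, …, (n−1)z ∉ Λ`** (Silverman AEC
Exercise 6.15 off the torsion of order `< n`), by a two-step induction on `n`.
[cite: SilvermanAEC2009, Exercise 6.15] -/
theorem weierstrassSigma_nat_mul_of_forall_notMem (z : ℂ) (n : ℕ)
    (h : ∀ k : ℕ, 1 ≤ k → k < n → (k : ℂ) * z ∉ L.lattice) :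
    L.weierstrassSigma (n * z) =
      (-1) ^ (n + 1) * (L.curve.ψ n).evalEval (℘[L] z) (℘'[L] z / 2) *
        L.weierstrassSigma z ^ (n ^ 2) := by
  induction n using Nat.strong_induction_on with
  | _ n ih =>
    rcases n with _ | _ | _ | m
    · -- `n = 0`: `σ(0) = 0`, `ψ₀ = 0`
      have e0 : ((0 : ℕ) : ℂ) = 0 := Nat.cast_zero
      have e0' : ((0 : ℕ) : ℤ) = 0 := Nat.cast_zero
      rw [e0, e0', zero_mul, WeierstrassCurve.ψ_zero, evalEval_zero, mul_zero, zero_mul]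
      exact (L.weierstrassSigma_eq_zero_iff_holds 0).mpr (zero_mem _)
    · -- `n = 1`
      have e1 : ((0 + 1 : ℕ) : ℂ) = 1 := by norm_num
      have e1' : ((0 + 1 : ℕ) : ℤ) = 1 := by norm_num
      rw [e1, e1', one_mul, WeierstrassCurve.ψ_one, evalEval_one]
      ring
    · -- `n = 2`: `σ(2z) = -℘'(z) σ(z)⁴`
      have hz : z ∉ L.lattice := by simpa using h 1 le_rfl (by omega)
      have e2 : ((0 + 1 + 1 : ℕ) : ℂ) = 2 := by norm_num
      have e2' : ((0 + 1 + 1 : ℕ) : ℤ) = 2 := by norm_num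
      rw [e2, e2', L.weierstrassSigma_two_mul hz, L.evalEval_ψ_two]
      ring
    · -- `n = m + 3`
      have hz : z ∉ L.lattice := by simpa using h 1 le_rfl (by omega)
      have hm1 : ((m + 1 : ℕ) : ℂ) * z ∉ L.lattice := h (m + 1) (by omega) (by omega)
      have hm2 : ((m + 2 : ℕ) : ℂ) * z ∉ L.lattice := h (m + 2) (by omega) (by omega)
      have hP1 := ih (m + 1) (by omega) fun k hk hkm => h k hk (by omega)
      have hP2 := ih (m + 2) (by omega) fun k hk hkm => h k hk (by omega)
      exact L.weierstrassSigma_nat_mul_step m hz hm1 hm2 hP1 hP2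

/-! ### Density of the non-torsion points and continuity -/

/-- The set of `z` some multiple `kz` (`k ≥ 1`) of which is a lattice point is countable (the
lattice is: tree `PeriodPair.countable_lattice`, `UniformizationUniqueProofs.lean`). [folklore] -/
theorem countable_setOf_exists_nat_mul_mem :
    {z : ℂ | ∃ k : ℕ, 1 ≤ k ∧ (k : ℂ) * z ∈ L.lattice}.Countable := by
  have hsub : {z : ℂ | ∃ k : ℕ, 1 ≤ k ∧ (k : ℂ) * z ∈ L.lattice} ⊆
      ⋃ k : ℕ, (fun l : ℂ => l / ((k : ℂ) + 1)) '' (L.lattice : Set ℂ) := by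
    rintro z ⟨k, hk, hkz⟩
    have hk0 : (k : ℂ) ≠ 0 := by exact_mod_cast (by omega : k ≠ 0)
    have hk1 : ((k - 1 : ℕ) : ℂ) + 1 = k := by
      rw [Nat.cast_sub hk]; push_cast; ring
    refine Set.mem_iUnion.mpr ⟨k - 1, ⟨(k : ℂ) * z, hkz, ?_⟩⟩
    show (k : ℂ) * z / (((k - 1 : ℕ) : ℂ) + 1) = z
    rw [hk1, mul_div_cancel_left₀ _ hk0]
  exact (Set.countable_iUnion fun k => L.countable_lattice.image _).mono hsub

/-- The points of infinite order (no multiple in `Λ`) are dense in `ℂ`. [folklore] -/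
theorem dense_setOf_forall_nat_mul_notMem :
    Dense {z : ℂ | ∀ k : ℕ, 1 ≤ k → (k : ℂ) * z ∉ L.lattice} := by
  have e : {z : ℂ | ∀ k : ℕ, 1 ≤ k → (k : ℂ) * z ∉ L.lattice} =
      {z : ℂ | ∃ k : ℕ, 1 ≤ k ∧ (k : ℂ) * z ∈ L.lattice}ᶜ := by
    ext z
    simp only [Set.mem_setOf_eq, Set.mem_compl_iff, not_exists, not_and]
  rw [e]
  exact L.countable_setOf_exists_nat_mul_mem.dense_compl ℂ

/-- A polynomial expression in `℘, ℘'/2` is continuous off the lattice. [folklore] -/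
theorem continuousOn_evalEval_weierstrassP (p : ℂ[X][Y]) :
    ContinuousOn (fun z => p.evalEval (℘[L] z) (℘'[L] z / 2)) (L.lattice : Set ℂ)ᶜ := by
  have h℘ : ContinuousOn ℘[L] (L.lattice : Set ℂ)ᶜ := L.differentiableOn_weierstrassP.continuousOn
  have h℘' : ContinuousOn (fun z => ℘'[L] z / 2) (L.lattice : Set ℂ)ᶜ :=
    L.differentiableOn_derivWeierstrassP.continuousOn.div_const _
  refine Polynomial.induction_on' p (fun p q hp hq => ?_) (fun n a => ?_)
  · simp only [evalEval_add]
    exact hp.add hq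
  · have e : ∀ x y : ℂ, (monomial n a).evalEval x y = a.eval x * y ^ n := by
      intro x y
      rw [Polynomial.evalEval, eval_monomial, eval_mul, eval_pow, eval_C]
    simp only [e]
    exact ((a.continuous).comp_continuousOn h℘).mul (h℘'.pow n)

/-! ### The identity everywhere -/

/-- **The division polynomials are `σ`-quotients** (Silverman AEC Exercise 6.15,
Frobenius–Stickelberger): for every `z ∈ ℂ` and `n ∈ ℕ`,
`σ(nz) = (−1)^{n+1} · ψₙ(℘ z, ℘' z/2) · σ(z)^{n²}`, i.e. `ψₙ(z) = (−1)^{n+1} σ(nz)/σ(z)^{n²}` off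
`Λ`. [cite: SilvermanAEC2009, Exercise 6.15] -/
theorem weierstrassSigma_nat_mul (n : ℕ) (z : ℂ) :
    L.weierstrassSigma (n * z) =
      (-1) ^ (n + 1) * (L.curve.ψ n).evalEval (℘[L] z) (℘'[L] z / 2) *
        L.weierstrassSigma z ^ (n ^ 2) := by
  rcases Nat.eq_zero_or_pos n with rfl | hn
  · simp only [Nat.cast_zero, zero_mul, WeierstrassCurve.ψ_zero, evalEval_zero, mul_zero, zero_mul]
    exact (L.weierstrassSigma_eq_zero_iff_holds 0).mpr (zero_mem _)
  by_cases hz : z ∈ L.lattice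
  · -- both sides vanish
    have h1 : L.weierstrassSigma (n * z) = 0 :=
      (L.weierstrassSigma_eq_zero_iff_holds _).mpr (by simpa [nsmul_eq_mul] using nsmul_mem hz n)
    have h2 : L.weierstrassSigma z = 0 := (L.weierstrassSigma_eq_zero_iff_holds _).mpr hz
    rw [h1, h2, zero_pow (pow_ne_zero 2 hn.ne'), mul_zero]
  · -- density + continuity on the open set `ℂ ∖ Λ`
    set S := {w : ℂ | ∀ k : ℕ, 1 ≤ k → (k : ℂ) * w ∉ L.lattice} with hS
    set U : Set ℂ := (L.lattice : Set ℂ)ᶜ with hU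
    have hUo : IsOpen U := L.isClosed_lattice.isOpen_compl
    have hσc : Continuous L.weierstrassSigma := L.differentiable_weierstrassSigma_holds.continuous
    have hf : ContinuousOn (fun w => L.weierstrassSigma (n * w)) U :=
      (hσc.comp (continuous_const.mul continuous_id)).continuousOn
    have hg : ContinuousOn (fun w => (-1) ^ (n + 1) * (L.curve.ψ n).evalEval (℘[L] w) (℘'[L] w / 2) *
        L.weierstrassSigma w ^ (n ^ 2)) U :=
      (continuousOn_const.mul (L.continuousOn_evalEval_weierstrassP _)).mul (hσc.continuousOn.pow _)
    have heq : Set.EqOn (fun w => L.weierstrassSigma (n * w))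
        (fun w => (-1) ^ (n + 1) * (L.curve.ψ n).evalEval (℘[L] w) (℘'[L] w / 2) *
          L.weierstrassSigma w ^ (n ^ 2)) (U ∩ S) := fun w hw =>
      L.weierstrassSigma_nat_mul_of_forall_notMem w n fun k hk _ => hw.2 k hk
    have key := heq.of_subset_closure hf hg Set.inter_subset_left
      (L.dense_setOf_forall_nat_mul_notMem.open_subset_closure_inter hUo)
    exact key hz

/-- The same with `σ(z)^{n²}` divided out, off the lattice:
**`ψₙ(℘ z, ℘' z/2) = (−1)^{n+1} σ(nz) / σ(z)^{n²}`** for `z ∉ Λ`. [cite: SilvermanAEC2009, Exercise 6.15] -/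
theorem evalEval_ψ_eq_weierstrassSigma_div {z : ℂ} (hz : z ∉ L.lattice) (n : ℕ) :
    (L.curve.ψ n).evalEval (℘[L] z) (℘'[L] z / 2) =
      (-1) ^ (n + 1) * L.weierstrassSigma (n * z) / L.weierstrassSigma z ^ (n ^ 2) := by
  have hs : L.weierstrassSigma z ^ (n ^ 2) ≠ 0 := pow_ne_zero _ (L.weierstrassSigma_ne_zero hz)
  have h2 : ((-1 : ℂ) ^ (n + 1)) ^ 2 = 1 := by
    rw [← pow_mul, Nat.mul_comm, pow_mul, neg_one_sq, one_pow]
  rw [eq_div_iff hs, L.weierstrassSigma_nat_mul n z]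
  linear_combination (-(L.curve.ψ n).evalEval (℘[L] z) (℘'[L] z / 2) *
    L.weierstrassSigma z ^ (n ^ 2)) * h2

end PeriodPair
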